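import Mathlib
import Literature.NumberTheory.MahlerMeasure.IntegerMahlerMeasure
import Literature.NumberTheory.MahlerMeasure.SmythNonreciprocalTheorem
import Literature.NumberTheory.MahlerMeasure.DobrowolskiTheorem
import HarnessLib

/-!
# The Mahler measure of an integer polynomial is a Perron algebraic integer, and an algebraic unit for monic `P` with `P(0) = ±1` (McKee–Smyth Prop. 1.9, Ex. 1.10) — re-homed proofs

**The Mahler measure of an integer polynomial is a Perron algebraic integer** (McKee–Smyth, *Around the Unit Circle*, Proposition 1.9:
`M(P)` is an algebraic integer for every `P ∈ ℤ[z]`; Exercise 1.10: `M(P)` is a Perron number — every other conjugate of `M(P)` has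
modulus `< M(P)`), together with the unit property read off from the proof of Proposition 1.9 (for `P` monic with `P(0) = ±1`, `M(P)⁻¹`
is an algebraic integer too) — RE-HOMED into `Literature/` by the Hodge foundations lane (`lit-hodgefound`, seat p20, generation 36) from
the venture cell `pub-namedobj` (seat `pub-namedobj-mahler`, gens 9–10): verbatim DECLARATION-LEVEL ports, in dependency order and each
with its original module docstring, of `Summits/Ventures/DiscreteObjects/Mahler/{MahlerMeasureAlgebraicInteger (all 5 declarations),
MahlerMeasureIntegral (all 10), MahlerMeasurePerron (4), MahlerMeasureUnit (2)}.lean`, namespace `Summit.Ventures.DiscreteObjects.Mahler`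
re-rooted as `Literature.NumberTheory.MahlerMeasure` (this file's path namespace).  The integer Mahler measure `intMahlerMeasure` and its
first properties are the sibling port `IntegerMahlerMeasure.lean`; `filter_roots_map_conj` (the roots outside the unit circle are closed
under conjugation) and the two multiset inequalities `one_le_prod_map_max_one_norm`, `norm_prod_le_prod_map_max` of `MahlerMeasurePerron`
were already re-homed in `SmythNonreciprocalTheorem.lean` / `DobrowolskiTheorem.lean` and are imported, not restated; the self-reciprocal
classification of `MahlerMeasureUnit` (McKee–Smyth Exercise A.5) is in `SmallMeasureStructure.lean`.

PROOF AS FORMALISED (the book's `p`-adic proof of Prop. 1.9, phrased with Gauss norms over the splitting field — Part headers carry the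
details): `|a|ᵥ ∏ max(1, |αᵢ|ᵥ) = ‖P‖ᵥ ≤ 1` at every finite place `v` (multiplicativity of the Gauss norm), so `a ∏_{i ∈ T} αᵢ` is `≤ 1`
at all finite places for EVERY sub-multiset `T` of the roots, hence an algebraic integer; `T` = roots outside the unit circle gives
Prop. 1.9, `T` = roots inside gives the unit property, and comparing `|τ(a ∏_{T} α)| ≤ |a| ∏ max(1,|γ|) = M(P)` over all embeddings `τ`
(equality only for `τ(T)` = the outside roots) gives the Perron property.  Theorems only (no definition, no named fact); imports
Mathlib/Literature only; every declaration carries the citation of the printed statement it formalises.  The Summits originals stay in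
place (transitional duplication).
-/

noncomputable section

/-!
## Part 1 — port of `Summits/Ventures/DiscreteObjects/Mahler/MahlerMeasureAlgebraicInteger.lean`

# The Mahler measure of a monic integer polynomial is an algebraic integer (venture `DiscreteObjects`, target L)

Cell `pub-namedobj`, seat `pub-namedobj-mahler` (gen 9). Framing: lottery ticket; floor = certified
bounds/negative ranges.

[McKee–Smyth, *Around the Unit Circle*, Prop. 1.9] (monic case): for a monic `P ∈ ℤ[X]`,
`M(P) = ∏_{|α|>1} |α| = |β|` with `β := ∏_{|α|>1} α`; the multiset of roots outside the unit circle is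
closed under complex conjugation (`filter_roots_map_conj`), so `β̄ = β` is real, and `β` is a product of
algebraic integers.  Hence `M(P) = ±β` is an algebraic integer (`IsIntegral ℤ`).  Used in
`SmythIsolationStrict` to make the gap in Smyth's theorem strict (`M(P) ≠ √((93+√2249)/80)`, which is
not an algebraic integer).

* `intMahlerMeasure_eq_norm_prod_roots` — `M(P) = ‖∏_{‖α‖>1} α‖` for monic `P`;
* `isIntegral_intMahlerMeasure_of_monic` — **`M(P)` is an algebraic integer** for monic `P ∈ ℤ[X]`.
-/

section Part1

namespace Literature.NumberTheory.MahlerMeasure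

open _root_.Polynomial
open scoped ComplexConjugate

/-- `(S.map max(1,‖·‖)).prod = ‖(S.filter (‖·‖ > 1)).prod‖` for a multiset of complex numbers.
[cite: MckeeSmyth2021, Proposition 1.9 p.23 (monic case: M(P) = |∏_{|α|>1} α|)] -/
theorem prod_map_max_one_norm (S : Multiset ℂ) :
    (S.map fun a => max 1 ‖a‖).prod = ‖(S.filter fun a => ¬ ‖a‖ ≤ 1).prod‖ := by
  induction S using Multiset.induction_on with
  | empty => simp
  | cons a S ih =>
    rw [Multiset.map_cons, Multiset.prod_cons, ih, Multiset.filter_cons]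
    by_cases h : ‖a‖ ≤ 1
    · rw [max_eq_left h, one_mul, if_neg (not_not.mpr h), zero_add]
    · rw [max_eq_right (not_le.mp h).le, if_pos h, Multiset.singleton_add, Multiset.prod_cons, norm_mul]

/-- **`M(P) = ‖∏_{‖α‖>1} α‖`** for a monic integer polynomial (product over the complex roots outside the
closed unit disc, with multiplicity).
[cite: MckeeSmyth2021, Proposition 1.9 p.23 (monic case: M(P) = |∏_{|α|>1} α|)] -/
theorem intMahlerMeasure_eq_norm_prod_roots {P : ℤ[X]} (hmonic : P.Monic) :
    intMahlerMeasure P = ‖(((P.map (Int.castRingHom ℂ)).roots).filter fun a => ¬ ‖a‖ ≤ 1).prod‖ := by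
  unfold intMahlerMeasure
  rw [mahlerMeasure_eq_leadingCoeff_mul_prod_roots, (hmonic.map _).leadingCoeff, norm_one, one_mul,
    prod_map_max_one_norm]

/-- The product of the roots outside the unit circle is real (the multiset is conjugation-closed).
[cite: MckeeSmyth2021, Proposition 1.9 p.23 (monic case: M(P) = |∏_{|α|>1} α|)] -/
theorem conj_prod_roots_outside (P : ℤ[X]) :
    conj ((((P.map (Int.castRingHom ℂ)).roots).filter fun a => ¬ ‖a‖ ≤ 1).prod) =
      (((P.map (Int.castRingHom ℂ)).roots).filter fun a => ¬ ‖a‖ ≤ 1).prod := by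
  rw [map_multiset_prod]
  congr 1
  exact filter_roots_map_conj P _ (fun α => by rw [Complex.norm_conj])

/-- Every complex root of a monic integer polynomial is an algebraic integer.
[cite: MckeeSmyth2021, Proposition 1.9 p.23 (monic case: M(P) = |∏_{|α|>1} α|)] -/
theorem isIntegral_of_mem_roots {P : ℤ[X]} (hmonic : P.Monic) {α : ℂ}
    (hα : α ∈ (P.map (Int.castRingHom ℂ)).roots) : IsIntegral ℤ α := by
  have h0 : P.map (Int.castRingHom ℂ) ≠ 0 := (hmonic.map _).ne_zero
  have hroot := (mem_roots h0).mp hα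
  refine ⟨P, hmonic, ?_⟩
  rw [IsRoot.def, eval_map] at hroot
  rwa [algebraMap_int_eq]

/-- **[McKee–Smyth, Prop. 1.9], monic case: `M(P)` is an algebraic integer** for a monic `P ∈ ℤ[X]`.
[cite: MckeeSmyth2021, Proposition 1.9 p.23 (monic case: M(P) = |∏_{|α|>1} α|)] -/
theorem isIntegral_intMahlerMeasure_of_monic {P : ℤ[X]} (hmonic : P.Monic) :
    IsIntegral ℤ (intMahlerMeasure P) := by
  set S₂ := ((P.map (Int.castRingHom ℂ)).roots).filter fun a => ¬ ‖a‖ ≤ 1 with hS₂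
  set β : ℂ := S₂.prod with hβ
  have hβint : IsIntegral ℤ β := by
    apply IsIntegral.multiset_prod
    intro x hx
    exact isIntegral_of_mem_roots hmonic (Multiset.mem_of_mem_filter hx)
  -- `β` is real
  have hβreal : ((β.re : ℝ) : ℂ) = β := Complex.conj_eq_iff_re.mp (conj_prod_roots_outside P)
  have hre : IsIntegral ℤ β.re := by
    rw [← hβreal] at hβint
    exact (isIntegral_algebraMap_iff (A := ℝ) (B := ℂ) (algebraMap ℝ ℂ).injective).mp hβint
  have hM : intMahlerMeasure P = |β.re| := by
    rw [intMahlerMeasure_eq_norm_prod_roots hmonic, ← hβ]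
    conv_lhs => rw [← hβreal]
    rw [Complex.norm_real, Real.norm_eq_abs]
  rw [hM]
  rcases abs_choice β.re with h | h
  · rw [h]; exact hre
  · rw [h]; exact hre.neg

end Literature.NumberTheory.MahlerMeasure

end Part1

/-!
## Part 2 — port of `Summits/Ventures/DiscreteObjects/Mahler/MahlerMeasureIntegral.lean`

# The Mahler measure of every integer polynomial is an algebraic integer (venture `DiscreteObjects`, target L)

Cell `pub-namedobj`, seat `pub-namedobj-mahler` (gen 10). Framing: lottery ticket; floor = certified
bounds/negative ranges.

[McKee–Smyth, *Around the Unit Circle*, Prop. 1.9] in full generality (gen 9 did the monic case,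
`isIntegral_intMahlerMeasure_of_monic`): for every `P ∈ ℤ[X]`, `M(P)` is an algebraic integer.

Kernel route (the book's `p`-adic proof, phrased with Gauss norms).  Write
`P = a ∏ (X - αᵢ)` over a splitting field `K` (a number field).  For a finite place `v` of `K` with
absolute value `| |ᵥ`, the Gauss norm is multiplicative (Mathlib `Polynomial.gaussNorm_mul`), so
`|a|ᵥ ∏ max(1, |αᵢ|ᵥ) = ‖P‖ᵥ ≤ 1` because `P` has integer coefficients; hence
`|a ∏_{i ∈ T} αᵢ|ᵥ ≤ 1` for EVERY sub-multiset `T` of the roots (`abv_mul_prod_le_gaussNorm`), and an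
element of `K` which is `≤ 1` at all finite places is an algebraic integer
(`IsDedekindDomain.HeightOneSpectrum.mem_integers_of_valuation_le_one`).  Embedding `K ↪ ℂ`:
`lc(P) · ∏_{α ∈ T} α` is an algebraic integer for every sub-multiset `T` of the complex roots of `P`
(`isIntegral_leadingCoeff_mul_prod_roots`) — in particular for the roots outside the unit circle,
whose product with `lc(P)` is real of absolute value `M(P)`.

* `abv_mul_prod_le_gaussNorm` — `|a · ∏ T|ᵥ ≤ ‖a ∏_{S}(X - α)‖ᵥ` for `T ≤ S` (nonarchimedean `v`);
* `isIntegral_of_adicAbv_le_one` — integrality criterion in a number field;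
* `isIntegral_leadingCoeff_mul_prod_of_splits` — number-field form;
* `isIntegral_leadingCoeff_mul_prod_roots` — `lc(P) · ∏ T` is an algebraic integer, `T ≤` complex roots;
* `intMahlerMeasure_eq_norm_leadingCoeff_mul_prod_roots` — `M(P) = ‖lc(P) · ∏_{‖α‖>1} α‖`;
* `isIntegral_intMahlerMeasure` — **Prop. 1.9: `M(P)` is an algebraic integer for every `P ∈ ℤ[X]`.**
-/

section Part2

namespace Literature.NumberTheory.MahlerMeasure

open _root_.Polynomial _root_.IsDedekindDomain
open scoped ComplexConjugate

/-! ### Gauss-norm domination over a field with a nonarchimedean absolute value -/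

section GaussNorm

variable {K : Type*} [Field K]

/-- For an absolute value `w`: `w α ≤ ‖X - α‖_w` and `1 ≤ ‖X - α‖_w` (Gauss norm at radius `1`).
[cite: MckeeSmyth2021, Proposition 1.9 pp.23–24 (M(P) is an algebraic integer; p-adic/Gauss-norm proof)] -/
theorem le_gaussNorm_X_sub_C (w : AbsoluteValue K ℝ) (α : K) :
    w α ≤ (X - C α).gaussNorm w 1 ∧ (1 : ℝ) ≤ (X - C α).gaussNorm w 1 := by
  constructor
  · have h := le_gaussNorm w (X - C α) zero_le_one 0
    simp only [coeff_sub, coeff_X_zero, coeff_C_zero, zero_sub, pow_zero, mul_one,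
      AbsoluteValue.map_neg] at h
    exact h
  · have h := le_gaussNorm w (X - C α) zero_le_one 1
    simp only [coeff_sub, coeff_X_one, coeff_C, if_neg one_ne_zero, sub_zero, pow_one, mul_one,
      AbsoluteValue.map_one] at h
    exact h

/-- The Gauss norm (radius `1`, nonarchimedean absolute value) of a product over a multiset.
[cite: MckeeSmyth2021, Proposition 1.9 pp.23–24 (M(P) is an algebraic integer; p-adic/Gauss-norm proof)] -/
theorem gaussNorm_multiset_prod (w : AbsoluteValue K ℝ) (hna : IsNonarchimedean w)
    (S : Multiset K[X]) : S.prod.gaussNorm w 1 = (S.map fun f => f.gaussNorm w 1).prod := by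
  induction S using Multiset.induction_on with
  | empty => rw [Multiset.prod_zero, Multiset.map_zero, Multiset.prod_zero, ← C_1, gaussNorm_C, map_one]
  | cons f S ih => rw [Multiset.prod_cons, Multiset.map_cons, Multiset.prod_cons,
      gaussNorm_mul hna one_pos, ih]

/-- A polynomial all of whose coefficients have absolute value `≤ 1` has Gauss norm `≤ 1`.
[cite: MckeeSmyth2021, Proposition 1.9 pp.23–24 (M(P) is an algebraic integer; p-adic/Gauss-norm proof)] -/
theorem gaussNorm_le_one_of_coeff (w : AbsoluteValue K ℝ) (f : K[X]) (h : ∀ i, w (f.coeff i) ≤ 1) :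
    f.gaussNorm w 1 ≤ 1 := by
  obtain ⟨i, hi⟩ := exists_eq_gaussNorm w 1 f
  rw [hi, one_pow, mul_one]
  exact h i

/-- **Gauss-norm domination.** For a nonarchimedean absolute value `w`, `a ∈ K` and multisets
`T ≤ S` of elements of `K`: `w (a · ∏ T) ≤ ‖a · ∏_{α ∈ S} (X - α)‖_w`
(`= w(a) ∏_{S} max(1, w α)` by multiplicativity of the Gauss norm).
[cite: MckeeSmyth2021, Proposition 1.9 pp.23–24 (M(P) is an algebraic integer; p-adic/Gauss-norm proof)] -/
theorem abv_mul_prod_le_gaussNorm (w : AbsoluteValue K ℝ) (hna : IsNonarchimedean w) (a : K)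
    {S T : Multiset K} (hTS : T ≤ S) :
    w (a * T.prod) ≤ (C a * (S.map fun α => X - C α).prod).gaussNorm w 1 := by
  obtain ⟨U, rfl⟩ := Multiset.le_iff_exists_add.mp hTS
  clear hTS
  have hg : ∀ α : K, w α ≤ (X - C α).gaussNorm w 1 ∧ (1 : ℝ) ≤ (X - C α).gaussNorm w 1 :=
    le_gaussNorm_X_sub_C w
  rw [gaussNorm_mul hna one_pos, gaussNorm_multiset_prod w hna, Multiset.map_map, Function.comp_def,
    Multiset.map_add, Multiset.prod_add, AbsoluteValue.map_mul, map_multiset_prod, gaussNorm_C]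
  set g : K → ℝ := fun α => (X - C α).gaussNorm w 1 with hgdef
  have h0 : 0 ≤ (T.map w).prod := Multiset.prod_nonneg (fun x hx => by
    obtain ⟨α, _, rfl⟩ := Multiset.mem_map.mp hx
    exact w.nonneg α)
  have h1 : (T.map w).prod ≤ (T.map g).prod :=
    Multiset.prod_map_le_prod_map₀ _ _ (fun α _ => w.nonneg α) (fun α _ => (hg α).1)
  have h2 : (1 : ℝ) ≤ (U.map g).prod := by
    induction U using Multiset.induction_on with
    | empty => simp
    | cons α U ih =>
      rw [Multiset.map_cons, Multiset.prod_cons]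
      have hα := (hg α).2
      nlinarith
  have hT0 : 0 ≤ (T.map g).prod := le_trans h0 h1
  calc w a * (T.map (fun α => w α)).prod = w a * (T.map w).prod := rfl
    _ ≤ w a * (T.map g).prod := mul_le_mul_of_nonneg_left h1 (w.nonneg a)
    _ ≤ w a * ((T.map g).prod * (U.map g).prod) := by
        apply mul_le_mul_of_nonneg_left _ (w.nonneg a)
        nlinarith

end GaussNorm

/-! ### Integrality in a number field -/

/-- An element of a number field with `v`-adic absolute value `≤ 1` at every finite place `v` is an
algebraic integer.
[cite: MckeeSmyth2021, Proposition 1.9 pp.23–24 (M(P) is an algebraic integer; p-adic/Gauss-norm proof)] -/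
theorem isIntegral_of_adicAbv_le_one {K : Type*} [Field K] [NumberField K] (x : K)
    (h : ∀ v : HeightOneSpectrum (NumberField.RingOfIntegers K),
      v.adicAbv (one_lt_two : (1 : NNReal) < 2) x ≤ 1) : IsIntegral ℤ x := by
  have hx : x ∈ (algebraMap (NumberField.RingOfIntegers K) K).range := by
    apply HeightOneSpectrum.mem_integers_of_valuation_le_one
    intro v
    have := h v
    rw [HeightOneSpectrum.adicAbv] at this
    simp only [AbsoluteValue.coe_mk, MulHom.coe_mk, HeightOneSpectrum.adicAbvDef] at this
    exact (WithZeroMulInt.toNNReal_le_one_iff one_lt_two).mp (by exact_mod_cast this)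
  obtain ⟨y, rfl⟩ := hx
  exact NumberField.RingOfIntegers.isIntegral_coe y

/-- **Number-field form.** If `P ∈ ℤ[X]` splits in the number field `K` and `T` is a sub-multiset of
its roots there, then `lc(P) · ∏ T` is an algebraic integer.
[cite: MckeeSmyth2021, Proposition 1.9 pp.23–24 (M(P) is an algebraic integer; p-adic/Gauss-norm proof)] -/
theorem isIntegral_leadingCoeff_mul_prod_of_splits {K : Type*} [Field K] [NumberField K] (P : ℤ[X])
    (hsplit : (P.map (algebraMap ℤ K)).Splits) {T : Multiset K}
    (hT : T ≤ (P.map (algebraMap ℤ K)).roots) :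
    IsIntegral ℤ (algebraMap ℤ K P.leadingCoeff * T.prod) := by
  apply isIntegral_of_adicAbv_le_one
  intro v
  set w : AbsoluteValue K ℝ := v.adicAbv (one_lt_two : (1 : NNReal) < 2) with hw
  have hna : IsNonarchimedean w := HeightOneSpectrum.isNonarchimedean_adicAbv v _
  have hf := hsplit.eq_prod_roots
  have hlc : (P.map (algebraMap ℤ K)).leadingCoeff = algebraMap ℤ K P.leadingCoeff :=
    leadingCoeff_map_of_injective (algebraMap ℤ K).injective_int P
  calc w (algebraMap ℤ K P.leadingCoeff * T.prod)
      ≤ (C (algebraMap ℤ K P.leadingCoeff) *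
          ((P.map (algebraMap ℤ K)).roots.map fun α => X - C α).prod).gaussNorm w 1 :=
        abv_mul_prod_le_gaussNorm w hna _ hT
    _ = (P.map (algebraMap ℤ K)).gaussNorm w 1 := by rw [← hlc, ← hf]
    _ ≤ 1 := by
        refine gaussNorm_le_one_of_coeff w _ fun i => ?_
        rw [coeff_map]
        have : algebraMap ℤ K (P.coeff i) =
            algebraMap (NumberField.RingOfIntegers K) K ((P.coeff i : ℤ) : NumberField.RingOfIntegers K) := by
          simp
        rw [this, hw]
        exact HeightOneSpectrum.adicAbv_coe_le_one v _ _

/-! ### Transfer to `ℂ` -/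

/-- A sub-multiset of an image multiset is an image of a sub-multiset.
[cite: MckeeSmyth2021, Proposition 1.9 pp.23–24 (M(P) is an algebraic integer; p-adic/Gauss-norm proof)] -/
theorem exists_le_map_eq_of_le_map {α β : Type*} [DecidableEq β] (f : α → β) :
    ∀ (S : Multiset α) (T : Multiset β), T ≤ S.map f → ∃ T' : Multiset α, T' ≤ S ∧ T'.map f = T := by
  intro S
  induction S using Multiset.induction_on with
  | empty =>
    intro T hT
    rw [Multiset.map_zero, Multiset.le_zero] at hT
    exact ⟨0, le_rfl, by rw [hT, Multiset.map_zero]⟩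
  | cons a S ih =>
    intro T hT
    rw [Multiset.map_cons] at hT
    by_cases ha : f a ∈ T
    · have hT' : T.erase (f a) ≤ S.map f := by
        rw [← Multiset.cons_erase ha, Multiset.cons_le_cons_iff] at hT
        exact hT
      obtain ⟨T', hT'S, hT'eq⟩ := ih _ hT'
      refine ⟨a ::ₘ T', Multiset.cons_le_cons a hT'S, ?_⟩
      rw [Multiset.map_cons, hT'eq, Multiset.cons_erase ha]
    · rw [Multiset.le_cons_of_notMem ha] at hT
      obtain ⟨T', hT'S, hT'eq⟩ := ih _ hT
      exact ⟨T', hT'S.trans (Multiset.le_cons_self S a), hT'eq⟩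

/-- **`lc(P) · ∏_{α ∈ T} α` is an algebraic integer** for every `P ∈ ℤ[X]` and every sub-multiset `T`
of the multiset of complex roots of `P` ([McKee–Smyth, proof of Prop. 1.9]: "`|a₀|_p` times the
product of any number of the `|α_j|_p` is at most `1`").
[cite: MckeeSmyth2021, Proposition 1.9 pp.23–24 (M(P) is an algebraic integer; p-adic/Gauss-norm proof)] -/
theorem isIntegral_leadingCoeff_mul_prod_roots (P : ℤ[X]) {T : Multiset ℂ}
    (hT : T ≤ (P.map (Int.castRingHom ℂ)).roots) :
    IsIntegral ℤ ((P.leadingCoeff : ℂ) * T.prod) := by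
  classical
  -- the splitting field of `P` over `ℚ`, a number field, with an embedding into `ℂ`
  let PQ : ℚ[X] := P.map (Int.castRingHom ℚ)
  let K := PQ.SplittingField
  haveI : CharZero K := charZero_of_injective_algebraMap (algebraMap ℚ K).injective
  haveI : NumberField K := NumberField.mk
  let φ : K →ₐ[ℚ] ℂ := IsAlgClosed.lift
  have hmapK : P.map (algebraMap ℤ K) = PQ.map (algebraMap ℚ K) := by
    show P.map (algebraMap ℤ K) = (P.map (Int.castRingHom ℚ)).map (algebraMap ℚ K)
    rw [Polynomial.map_map]
    congr 1
  have hsplitK : (P.map (algebraMap ℤ K)).Splits := by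
    rw [hmapK]
    exact SplittingField.splits PQ
  have hPC : P.map (Int.castRingHom ℂ) = (P.map (algebraMap ℤ K)).map φ.toRingHom := by
    rw [Polynomial.map_map]
    congr 1
    exact RingHom.ext_int _ _
  have hroots : (P.map (Int.castRingHom ℂ)).roots = ((P.map (algebraMap ℤ K)).roots).map φ := by
    rw [hPC, ← roots_map_of_injective_of_card_eq_natDegree φ.toRingHom.injective
      (splits_iff_card_roots.mp hsplitK)]
    rfl
  rw [hroots] at hT
  obtain ⟨T', hT'le, rfl⟩ := exists_le_map_eq_of_le_map φ _ _ hT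
  have hint := isIntegral_leadingCoeff_mul_prod_of_splits P hsplitK hT'le
  have himg : (P.leadingCoeff : ℂ) * (T'.map φ).prod = φ (algebraMap ℤ K P.leadingCoeff * T'.prod) := by
    rw [map_mul, map_multiset_prod]
    congr 1
    simp
  rw [himg]
  exact map_isIntegral_int φ.toRingHom hint

/-! ### Prop. 1.9 -/

/-- `M(P) = ‖lc(P) · ∏_{‖α‖>1} α‖` (complex roots with multiplicity) for every `P ∈ ℤ[X]`.
[cite: MckeeSmyth2021, Proposition 1.9 pp.23–24 (M(P) is an algebraic integer; p-adic/Gauss-norm proof)] -/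
theorem intMahlerMeasure_eq_norm_leadingCoeff_mul_prod_roots (P : ℤ[X]) :
    intMahlerMeasure P = ‖(P.leadingCoeff : ℂ) *
      (((P.map (Int.castRingHom ℂ)).roots).filter fun a => ¬ ‖a‖ ≤ 1).prod‖ := by
  unfold intMahlerMeasure
  rw [mahlerMeasure_eq_leadingCoeff_mul_prod_roots, prod_map_max_one_norm, norm_mul,
    leadingCoeff_map_of_injective (Int.castRingHom ℂ).injective_int, eq_intCast]

/-- **[McKee–Smyth, Prop. 1.9]: the Mahler measure of every `P ∈ ℤ[X]` is an algebraic integer.**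
[cite: MckeeSmyth2021, Proposition 1.9 pp.23–24 (M(P) is an algebraic integer; p-adic/Gauss-norm proof)] -/
theorem isIntegral_intMahlerMeasure (P : ℤ[X]) : IsIntegral ℤ (intMahlerMeasure P) := by
  classical
  set S₂ := ((P.map (Int.castRingHom ℂ)).roots).filter fun a => ¬ ‖a‖ ≤ 1 with hS₂
  set β : ℂ := (P.leadingCoeff : ℂ) * S₂.prod with hβ
  have hβint : IsIntegral ℤ β := isIntegral_leadingCoeff_mul_prod_roots P (Multiset.filter_le _ _)
  -- `β` is real
  have hβconj : conj β = β := by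
    rw [hβ, map_mul, conj_prod_roots_outside P, map_intCast]
  have hβreal : ((β.re : ℝ) : ℂ) = β := Complex.conj_eq_iff_re.mp hβconj
  have hre : IsIntegral ℤ β.re := by
    rw [← hβreal] at hβint
    exact (isIntegral_algebraMap_iff (A := ℝ) (B := ℂ) (algebraMap ℝ ℂ).injective).mp hβint
  have hM : intMahlerMeasure P = |β.re| := by
    rw [intMahlerMeasure_eq_norm_leadingCoeff_mul_prod_roots, ← hS₂, ← hβ]
    conv_lhs => rw [← hβreal]
    rw [Complex.norm_real, Real.norm_eq_abs]
  rw [hM]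
  rcases abs_choice β.re with h | h
  · rw [h]; exact hre
  · rw [h]; exact hre.neg

end Literature.NumberTheory.MahlerMeasure

end Part2

/-!
## Part 3 — port of `Summits/Ventures/DiscreteObjects/Mahler/MahlerMeasurePerron.lean` (4 declarations kept)

# The Mahler measure of an integer polynomial is a Perron number (venture `DiscreteObjects`, target L)

Cell `pub-namedobj`, seat `pub-namedobj-mahler` (gen 10). Framing: lottery ticket; floor = certified
bounds/negative ranges.

[McKee–Smyth, *Around the Unit Circle*, Exercise 1.10 (p. 8)]: "Show that the Mahler measure `M(P)` of an
integer polynomial `P` is a Perron number" — a real positive algebraic integer all of whose other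
conjugates have modulus strictly less than itself.  Integrality is `isIntegral_intMahlerMeasure`
(Prop. 1.9, `MahlerMeasureIntegral`); here we prove the conjugate bound.

Kernel route.  Over the splitting field `K` of `P` (a number field) with a fixed embedding
`φ₀ : K → ℂ`, put `β = a ∏_{α ∈ S} α` with `a = lc(P)` and `S` the roots `α` of `P` in `K` with
`|φ₀ α| > 1`; then `φ₀ β = a ∏_{|γ|>1} γ =: β_ℂ` is real with `|β_ℂ| = M(P)`.  Every conjugate of `β_ℂ`
is `τ β = a ∏_{α ∈ S} τ α` for an embedding `τ : K → ℂ` (Mathlib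
`NumberField.Embeddings.range_eval_eq_rootSet_minpoly`), and `τ` maps the roots of `P` in `K` onto the
complex roots; so `|τ β| ≤ |a| ∏_{all γ} max(1, |γ|) = M(P)`, with equality only if the multiset `τ(S)`
is exactly the multiset of roots outside the unit circle, i.e. only if `τ β = β_ℂ`
(`norm_mul_prod_lt_of_outside`, `exists_outside_of_ne_filter`).

* `norm_mul_prod_le_of_le` / `norm_mul_prod_lt_of_outside` / `exists_outside_of_ne_filter` — multiset
  inequalities behind "`|conjugate| < M` unless it is `M`";
* `isConjRoot_leadingCoeff_mul_prod_roots` — conjugates of `β_ℂ = lc(P) ∏_{|γ|>1} γ` are `β_ℂ` or of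
  modulus `< M(P)`;
* `intMahlerMeasure_isPerron` — **every conjugate `γ ≠ M(P)` of `M(P)` over `ℚ` has `|γ| < M(P)`.**
-/

section Part3

namespace Literature.NumberTheory.MahlerMeasure

open _root_.Polynomial
open scoped ComplexConjugate

/-! ### Multiset inequalities -/

/-- Strict version: if `a ≠ 0` and the complement `U` (`R = T + U`) contains some `γ` with `‖γ‖ > 1`,
then `‖a · ∏ T‖ < ‖a‖ · ∏_{R} max(1, ‖γ‖)`. [cite: MckeeSmyth2021, Exercise 1.10 p.24 (M(P) is a Perron number)] -/
theorem norm_mul_prod_lt_of_outside {a : ℂ} (ha : a ≠ 0) (T U : Multiset ℂ) {γ : ℂ} (hγU : γ ∈ U)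
    (hγ : ¬ ‖γ‖ ≤ 1) :
    ‖a * T.prod‖ < ‖a‖ * ((T + U).map fun γ => max 1 ‖γ‖).prod := by
  rw [norm_mul, Multiset.map_add, Multiset.prod_add]
  have ha' : 0 < ‖a‖ := norm_pos_iff.mpr ha
  have h1 := norm_prod_le_prod_map_max T
  have hT1 : (1 : ℝ) ≤ (T.map fun γ => max 1 ‖γ‖).prod := one_le_prod_map_max_one_norm T
  -- `∏_U max(1,‖·‖) > 1`
  obtain ⟨U', rfl⟩ := Multiset.exists_cons_of_mem hγU
  rw [Multiset.map_cons, Multiset.prod_cons]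
  have hγ' : (1 : ℝ) < max 1 ‖γ‖ := lt_max_of_lt_right (not_le.mp hγ)
  have hU' := one_le_prod_map_max_one_norm U'
  have h2 : (1 : ℝ) < max 1 ‖γ‖ * (U'.map fun γ => max 1 ‖γ‖).prod := by nlinarith
  calc ‖a‖ * ‖T.prod‖ ≤ ‖a‖ * (T.map fun γ => max 1 ‖γ‖).prod := mul_le_mul_of_nonneg_left h1 ha'.le
    _ = ‖a‖ * (T.map fun γ => max 1 ‖γ‖).prod * 1 := (mul_one _).symm
    _ < ‖a‖ * (T.map fun γ => max 1 ‖γ‖).prod *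
          (max 1 ‖γ‖ * (U'.map fun γ => max 1 ‖γ‖).prod) := by
        apply mul_lt_mul_of_pos_left h2
        positivity
    _ = ‖a‖ * ((T.map fun γ => max 1 ‖γ‖).prod *
          (max 1 ‖γ‖ * (U'.map fun γ => max 1 ‖γ‖).prod)) := by ring

/-- If `R = T + U`, `|T| = |{γ ∈ R : ‖γ‖ > 1}|` and `T` is not that sub-multiset, then `U` contains some
`γ` with `‖γ‖ > 1`. [cite: MckeeSmyth2021, Exercise 1.10 p.24 (M(P) is a Perron number)] -/
theorem exists_outside_of_ne_filter (T U : Multiset ℂ)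
    (hcard : Multiset.card T = Multiset.card ((T + U).filter fun γ => ¬ ‖γ‖ ≤ 1))
    (hne : T ≠ (T + U).filter fun γ => ¬ ‖γ‖ ≤ 1) : ∃ γ ∈ U, ¬ ‖γ‖ ≤ 1 := by
  by_contra h
  push Not at h
  have hU : U.filter (fun γ => ¬ ‖γ‖ ≤ 1) = 0 :=
    Multiset.filter_eq_nil.mpr (fun γ hγ hn => hn (h γ hγ))
  rw [Multiset.filter_add, hU, add_zero] at hcard hne
  have hle : T.filter (fun γ => ¬ ‖γ‖ ≤ 1) ≤ T := Multiset.filter_le _ T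
  exact hne (Multiset.eq_of_le_of_card_le hle hcard.le).symm

/-! ### Conjugates -/

/-- **Conjugates of `β_ℂ = lc(P) · ∏_{|γ|>1} γ`.**  For `P ∈ ℤ[X]`, `P ≠ 0`, with complex roots `R`
(multiset) and `β_ℂ = lc(P) · ∏ (R.filter (|γ| > 1))`: every conjugate of `β_ℂ` over `ℚ` is `β_ℂ` itself
or has modulus `< M(P) = |β_ℂ|`. [cite: MckeeSmyth2021, Exercise 1.10 p.24 (M(P) is a Perron number)] -/
theorem isConjRoot_leadingCoeff_mul_prod_roots {P : ℤ[X]} (hP : P ≠ 0) {γ : ℂ}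
    (hγ : IsConjRoot ℚ ((P.leadingCoeff : ℂ) *
      (((P.map (Int.castRingHom ℂ)).roots).filter fun a => ¬ ‖a‖ ≤ 1).prod) γ) :
    γ = (P.leadingCoeff : ℂ) * (((P.map (Int.castRingHom ℂ)).roots).filter fun a => ¬ ‖a‖ ≤ 1).prod ∨
      ‖γ‖ < intMahlerMeasure P := by
  classical
  -- splitting field, a fixed embedding `φ₀`, roots in `K`
  let PQ : ℚ[X] := P.map (Int.castRingHom ℚ)
  let K := PQ.SplittingField
  haveI : CharZero K := charZero_of_injective_algebraMap (algebraMap ℚ K).injective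
  haveI : NumberField K := NumberField.mk
  let φ₀ : K →ₐ[ℚ] ℂ := IsAlgClosed.lift
  have hmapK : P.map (algebraMap ℤ K) = PQ.map (algebraMap ℚ K) := by
    show P.map (algebraMap ℤ K) = (P.map (Int.castRingHom ℚ)).map (algebraMap ℚ K)
    rw [Polynomial.map_map]
    congr 1
  have hsplitK : (P.map (algebraMap ℤ K)).Splits := by
    rw [hmapK]
    exact SplittingField.splits PQ
  set RK := (P.map (algebraMap ℤ K)).roots with hRK
  set RC := (P.map (Int.castRingHom ℂ)).roots with hRC
  -- every embedding `τ : K →+* ℂ` maps the roots of `P` in `K` onto the complex roots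
  have hroots : ∀ τ : K →+* ℂ, RK.map τ = RC := by
    intro τ
    have hPC : P.map (Int.castRingHom ℂ) = (P.map (algebraMap ℤ K)).map τ := by
      rw [Polynomial.map_map]
      congr 1
      exact RingHom.ext_int _ _
    rw [hRC, hPC, hRK]
    exact roots_map_of_injective_of_card_eq_natDegree τ.injective (splits_iff_card_roots.mp hsplitK)
  -- `S` = roots whose `φ₀`-image lies outside the closed unit disc; `β = a · ∏ S`
  set S := RK.filter fun α => ¬ ‖φ₀ α‖ ≤ 1 with hS
  set aK : K := algebraMap ℤ K P.leadingCoeff with haK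
  set β : K := aK * S.prod with hβ
  set SC := RC.filter fun a => ¬ ‖a‖ ≤ 1 with hSC
  have hSφ : S.map φ₀ = SC := by
    rw [hSC, ← hroots φ₀.toRingHom, hS]
    rw [AlgHom.toRingHom_eq_coe, RingHom.coe_coe, Multiset.filter_map]
    rfl
  have haφ : ∀ τ : K →+* ℂ, τ aK = (P.leadingCoeff : ℂ) := by
    intro τ
    rw [haK]
    simp
  have hβφ : φ₀ β = (P.leadingCoeff : ℂ) * SC.prod := by
    rw [hβ, map_mul, map_multiset_prod, hSφ, ← haφ φ₀.toRingHom]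
    rfl
  -- the conjugate `γ` is `τ β` for some embedding `τ`
  have hmin : minpoly ℚ (φ₀ β) = minpoly ℚ β := minpoly.algHom_eq φ₀ φ₀.injective β
  have hγroot : γ ∈ (minpoly ℚ β).rootSet ℂ := by
    rw [← hmin, hβφ]
    have hint : IsIntegral ℚ ((P.leadingCoeff : ℂ) * SC.prod) := by
      rw [← hβφ]
      exact (Algebra.IsIntegral.isIntegral (R := ℚ) β).map φ₀
    exact (isConjRoot_iff_mem_minpoly_rootSet hint).mp hγ
  rw [← NumberField.Embeddings.range_eval_eq_rootSet_minpoly K ℂ β] at hγroot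
  obtain ⟨τ, hτ⟩ := hγroot
  -- `τ β = a · ∏ τ(S)` with `τ(S) ≤` complex roots, `|τ(S)| = |SC|`
  have hτβ : τ β = (P.leadingCoeff : ℂ) * (S.map τ).prod := by
    rw [hβ, map_mul, map_multiset_prod, haφ τ]
  have hle : S.map τ ≤ RC := by
    rw [← hroots τ]
    exact Multiset.map_le_map (Multiset.filter_le _ _)
  obtain ⟨U, hU⟩ := Multiset.le_iff_exists_add.mp hle
  have hcardS : Multiset.card (S.map τ) = Multiset.card SC := by
    rw [Multiset.card_map, ← hSφ, Multiset.card_map]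
  have ha0 : (P.leadingCoeff : ℂ) ≠ 0 := by exact_mod_cast leadingCoeff_ne_zero.mpr hP
  have hM : intMahlerMeasure P = ‖(P.leadingCoeff : ℂ)‖ * (RC.map fun γ => max 1 ‖γ‖).prod := by
    unfold intMahlerMeasure
    rw [mahlerMeasure_eq_leadingCoeff_mul_prod_roots,
      leadingCoeff_map_of_injective (Int.castRingHom ℂ).injective_int, eq_intCast]
  rw [← hτ]
  change τ β = _ ∨ ‖τ β‖ < _
  by_cases heq : S.map τ = SC
  · left
    rw [hτβ, heq]
  · right
    rw [hτβ, hM, hU]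
    rw [hU] at hSC
    have hne : S.map τ ≠ (S.map τ + U).filter fun γ => ¬ ‖γ‖ ≤ 1 := by rwa [← hSC]
    have hcard' : Multiset.card (S.map τ) =
        Multiset.card ((S.map τ + U).filter fun γ => ¬ ‖γ‖ ≤ 1) := by rw [← hSC]; exact hcardS
    obtain ⟨γ', hγ'U, hγ'⟩ := exists_outside_of_ne_filter _ _ hcard' hne
    exact norm_mul_prod_lt_of_outside ha0 _ _ hγ'U hγ'

/-- **[McKee–Smyth, Exercise 1.10]: `M(P)` is a Perron number.**  For every `P ∈ ℤ[X]`, every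
conjugate `γ ∈ ℂ` of `M(P)` over `ℚ` (a root of the minimal polynomial of `M(P)`) is `M(P)` itself or
satisfies `|γ| < M(P)`.  With `isIntegral_intMahlerMeasure` (`M(P)` is an algebraic integer) and
`M(P) ≥ 1 > 0` for `P ≠ 0`, this says that `M(P)` is a Perron number.
[cite: MckeeSmyth2021, Exercise 1.10 p.24 (M(P) is a Perron number)] -/
theorem intMahlerMeasure_isPerron (P : ℤ[X]) {γ : ℂ}
    (hγ : IsConjRoot ℚ ((intMahlerMeasure P : ℝ) : ℂ) γ) :
    γ = ((intMahlerMeasure P : ℝ) : ℂ) ∨ ‖γ‖ < intMahlerMeasure P := by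
  classical
  by_cases hP : P = 0
  · left
    have hM0 : intMahlerMeasure P = 0 := by
      unfold intMahlerMeasure; rw [hP, Polynomial.map_zero, mahlerMeasure_zero]
    rw [hM0, Complex.ofReal_zero] at hγ ⊢
    have h := hγ.aeval_eq_zero
    rwa [minpoly.zero, aeval_X] at h
  set SC := ((P.map (Int.castRingHom ℂ)).roots).filter fun a => ¬ ‖a‖ ≤ 1 with hSC
  set βC : ℂ := (P.leadingCoeff : ℂ) * SC.prod with hβC
  -- `β_ℂ` is real and `M(P) = |β_ℂ|`, so `M(P) = ± β_ℂ`
  have hβconj : conj βC = βC := by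
    rw [hβC, map_mul, conj_prod_roots_outside P, map_intCast]
  have hβreal : ((βC.re : ℝ) : ℂ) = βC := Complex.conj_eq_iff_re.mp hβconj
  have hMabs : intMahlerMeasure P = |βC.re| := by
    rw [intMahlerMeasure_eq_norm_leadingCoeff_mul_prod_roots, ← hSC, ← hβC]
    conv_lhs => rw [← hβreal]
    rw [Complex.norm_real, Real.norm_eq_abs]
  rcases abs_choice βC.re with h | h
  · -- `M = β_ℂ`
    have hMC : ((intMahlerMeasure P : ℝ) : ℂ) = βC := by rw [hMabs, h, hβreal]
    rw [hMC] at hγ ⊢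
    rcases isConjRoot_leadingCoeff_mul_prod_roots hP hγ with h1 | h1
    · exact Or.inl h1
    · exact Or.inr h1
  · -- `M = -β_ℂ`: conjugates of `-β_ℂ` are negatives of conjugates of `β_ℂ`
    have hMC : ((intMahlerMeasure P : ℝ) : ℂ) = -βC := by
      rw [hMabs, h, Complex.ofReal_neg, hβreal]
    rw [hMC] at hγ ⊢
    have hγ' : IsConjRoot ℚ βC (-γ) := by
      have := hγ.neg
      rwa [neg_neg] at this
    rcases isConjRoot_leadingCoeff_mul_prod_roots hP hγ' with h1 | h1
    · left
      have h1' : -γ = βC := by rw [hβC, hSC]; exact h1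
      rw [← h1', neg_neg]
    · right
      rwa [norm_neg] at h1

end Literature.NumberTheory.MahlerMeasure

end Part3

/-!
## Part 4 — port of `Summits/Ventures/DiscreteObjects/Mahler/MahlerMeasureUnit.lean` (2 declarations kept)

# `M(P)` is an algebraic unit when `P` is monic with `P(0) = ±1`; irreducible self-reciprocal polynomials
(venture `DiscreteObjects`, target L)

Cell `pub-namedobj`, seat `pub-namedobj-mahler` (gen 10). Framing: lottery ticket; floor = certified
bounds/negative ranges.

1. **Units.** For a monic `P ∈ ℤ[X]` with `P(0) = ±1` — in particular for every candidate of the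
   small-measure census (reciprocal, monic) — the Mahler measure `M(P)` is a UNIT of the ring of
   algebraic integers: both `M(P)` and `M(P)⁻¹` are algebraic integers.  Indeed `M(P) = |β|`,
   `β = ∏_{|α|>1} α`, and `β⁻¹ = ±∏_{|α|≤1} α` is again a sub-product of the roots, integral by
   `isIntegral_leadingCoeff_mul_prod_roots` ([McKee–Smyth, proof of Prop. 1.9]).
   `isIntegral_inv_intMahlerMeasure`, `intMahlerMeasure_unit`.
2. **[McKee–Smyth, Exercise A.5]** An irreducible `P ∈ ℤ[X]` with `P.reverse = ±P` is `±(X - 1)`,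
   `±(X + 1)`, or palindromic (`P.reverse = P`) of even degree: `self_reciprocal_irreducible_classification`.
-/

section Part4

namespace Literature.NumberTheory.MahlerMeasure

open _root_.Polynomial
open scoped ComplexConjugate

/-! ### `M(P)⁻¹` is an algebraic integer for monic `P` with `P(0) = ±1` -/

/-- For a monic `P ∈ ℤ[X]` with `P(0) = ±1`, `M(P)⁻¹` is an algebraic integer (so `M(P)` is a unit
in the ring of algebraic integers).
[cite: MckeeSmyth2021, Proposition 1.9 pp.23–24 (proof: every sub-product a₀∏α_j of the roots is an algebraic integer)] -/
theorem isIntegral_inv_intMahlerMeasure {P : ℤ[X]} (hmonic : P.Monic) (h0 : P.coeff 0 = 1 ∨ P.coeff 0 = -1) :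
    IsIntegral ℤ (intMahlerMeasure P)⁻¹ := by
  classical
  set R := (P.map (Int.castRingHom ℂ)).roots with hR
  set S₂ := R.filter fun a => ¬ ‖a‖ ≤ 1 with hS₂
  set S₁ := R.filter fun a => ‖a‖ ≤ 1 with hS₁
  have hsplitR : S₁ + S₂ = R := Multiset.filter_add_not _ R
  -- `∏ R = ± 1` from `P(0) = ±1` and monicity
  have hPC : P.map (Int.castRingHom ℂ) = (R.map fun α => X - C α).prod := by
    have h := (IsAlgClosed.splits (P.map (Int.castRingHom ℂ))).eq_prod_roots_of_monic (hmonic.map _)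
    rw [← hR] at h; exact h
  have hprodR : R.prod = 1 ∨ R.prod = -1 := by
    have h1 : ((P.coeff 0 : ℤ) : ℂ) = (R.map fun α => -α).prod := by
      rw [← eq_intCast (Int.castRingHom ℂ), ← coeff_map, hPC, coeff_zero_multiset_prod, Multiset.map_map]
      exact congrArg _ (Multiset.map_congr rfl fun α _ => by simp)
    have h2 : (R.map fun α => -α).prod = (-1) ^ Multiset.card R * R.prod := by
      rw [← Multiset.prod_map_neg]
    rw [h2] at h1
    rcases h0 with h | h <;> rw [h] at h1 <;> push_cast at h1 <;>
      rcases neg_one_pow_eq_or ℂ (Multiset.card R) with h3 | h3 <;> rw [h3] at h1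
    · left; linear_combination -h1
    · right; linear_combination h1
    · right; linear_combination -h1
    · left; linear_combination h1
  -- `β = ∏ S₂`, `β⁻¹ = ± ∏ S₁`
  set β : ℂ := S₂.prod with hβ
  have hβS₁ : β * S₁.prod = 1 ∨ β * S₁.prod = -1 := by
    rw [hβ, mul_comm, ← Multiset.prod_add, hsplitR]; exact hprodR
  have hβ0 : β ≠ 0 := by
    intro h; rcases hβS₁ with h' | h' <;> rw [h, zero_mul] at h' <;> norm_num at h'
  have hS₁int : IsIntegral ℤ S₁.prod := by
    have h := isIntegral_leadingCoeff_mul_prod_roots P (T := S₁) (Multiset.filter_le _ _)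
    rwa [hmonic.leadingCoeff, Int.cast_one, one_mul] at h
  have hβinv : IsIntegral ℤ β⁻¹ := by
    rcases hβS₁ with h | h
    · have : β⁻¹ = S₁.prod := (eq_inv_of_mul_eq_one_right h).symm
      rw [this]; exact hS₁int
    · have : β⁻¹ = -S₁.prod := by
        have h' : β * (-S₁.prod) = 1 := by rw [mul_neg, h, neg_neg]
        exact (eq_inv_of_mul_eq_one_right h').symm
      rw [this]; exact hS₁int.neg
  -- `M(P) = ‖β‖`, `β` real
  have hM : intMahlerMeasure P = ‖β‖ := by
    rw [intMahlerMeasure_eq_norm_prod_roots hmonic]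
  have hβconj : conj β = β := conj_prod_roots_outside P
  have hβinv_real : (((β⁻¹).re : ℝ) : ℂ) = β⁻¹ :=
    Complex.conj_eq_iff_re.mp (by rw [map_inv₀, hβconj])
  have hre : IsIntegral ℤ (β⁻¹).re := by
    rw [← hβinv_real] at hβinv
    exact (isIntegral_algebraMap_iff (A := ℝ) (B := ℂ) (algebraMap ℝ ℂ).injective).mp hβinv
  have hMinv : (intMahlerMeasure P)⁻¹ = |(β⁻¹).re| := by
    rw [hM, ← norm_inv]
    conv_lhs => rw [← hβinv_real]
    rw [Complex.norm_real, Real.norm_eq_abs]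
  rw [hMinv]
  rcases abs_choice (β⁻¹).re with h | h
  · rw [h]; exact hre
  · rw [h]; exact hre.neg

/-- **`M(P)` is an algebraic unit** for monic `P ∈ ℤ[X]` with `P(0) = ±1`: `M(P)` and `M(P)⁻¹` are both
algebraic integers.  (Applies to every reciprocal monic polynomial, hence to every candidate of the
small-measure census and to Lehmer's number.)
[cite: MckeeSmyth2021, Proposition 1.9 pp.23–24 (proof: every sub-product a₀∏α_j of the roots is an algebraic integer)] -/
theorem intMahlerMeasure_unit {P : ℤ[X]} (hmonic : P.Monic) (h0 : P.coeff 0 = 1 ∨ P.coeff 0 = -1) :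
    IsIntegral ℤ (intMahlerMeasure P) ∧ IsIntegral ℤ (intMahlerMeasure P)⁻¹ :=
  ⟨isIntegral_intMahlerMeasure P, isIntegral_inv_intMahlerMeasure hmonic h0⟩

/-! ### Irreducible self-reciprocal polynomials ([McKee–Smyth, Exercise A.5]) -/

end Literature.NumberTheory.MahlerMeasure

end Part4

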